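import Summits.ValiantsHypothesis.ValiantsHypothesis.Theorems.BarrierLeverPriorityPeelingPairMove
import Summits.ValiantsHypothesis.ValiantsHypothesis.Theorems.BarrierLeverPartitionMinorsHitByVPProductStates

/-!
# Route BarrierLever — item `PartitionMinorsHitByVP` (stmt-ValiantsHypothesis-19717):
# DOWN-COMPRESSION of a layout is realised on EVERY witness by one linear factor

Helper file (`--supports stmt-ValiantsHypothesis-19717`; cell valiant-natproofs, rung V4, 𝒟-side door
(c); prover seat val-np-p1 gen 12). Definition-free. Closes NO item. Part 1/2 of the witness-agnostic
LOWER-SET REDUCTION of item 19717 (part 2: `…PartitionMinorsHitByVPOfLowerSets`).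

**Setting.** Item 19717 asks, for a layout `(u, w)` (`u i, w j ⊆ Fin h`, `i j : Fin r`), for a
polynomial `f` in `x_a = X (Fin.castAdd h a)`, `y_c = X (Fin.natAdd h c)` of small circuit size whose
Nisan partition minor `det (coeff_{x^{u i} y^{w j}} f)_{i j}` is nonzero. Only MULTILINEAR coefficients
are read, so the relevant object is the image of `f` in the zeon algebra `ℂ[x, y]/(x_a², y_c²)`.

**The observation (new for the item; the cell's compression moves so far act on ONE witness family —
TT layouts, `Compression.compressionMove`).** For ANY polynomial `f` and scalar `t`,
`coeff_{x^U y^W} (f · (1 + t x_a)) = coeff_{x^U y^W} f + t · [a ∈ U] · coeff_{x^{U∖a} y^W} f`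
(`coeff_partitionExpo_mul_one_add_x`; the square `x_a²` never reaches a multilinear coefficient).
Hence multiplying the witness by `1 + t x_a` multiplies the partition matrix on the LEFT by the
Kronecker factor `(1 0; t 1)` in coordinate `a`: row `U ∋ a` becomes `row_U + t · row_{U∖a}`.
Rows `U ∋ a` whose shadow `U ∖ a` is itself a row («blocked») contribute nothing new (subtract
`t ·` that row), rows `U ∋ a` with `U ∖ a` not a row («moved») carry degree `1` in `t`, and the top
`t`-coefficient of the determinant is EXACTLY the partition minor of the DOWN-COMPRESSED layout
`𝓓_a u` (`u i ↦ u i ∖ a` for the moved rows) — `det_ne_zero_of_rowCompression` (pure matrix lemma,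
via `PriorityPeeling.coeff_det_of_natDegree_le_col` on the transpose), `step_x`. The same with a
factor `1 + s y_c` for the columns (`coeff_partitionExpo_mul_one_add_y`, `step_y`). So: **if some `f`
hits `(𝓓_a u, w)` then `f · (1 + t x_a)` hits `(u, w)` for some `t ∈ ℂ`** — for every witness class
closed under multiplication by linear factors (all of `VP`; size `+3`, degree `+1`).

**Combinatorics of one pass** (compression preserves injectivity, `𝓓_b` preserves
`a`-compressedness, a family compressed in every coordinate has a lower-set range) is the
Mathlib-only companion `…PartitionMinorsHitByVPDownCompressionPass`. Here «`v` is the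
`a`-compression of `u`» is the pair of hypotheses `hv₁ / hv₂` of `step_x` (a row `u i ∋ a` whose
shadow `u i ∖ a` is not a row is replaced by its shadow, every other row is kept) — spelled out,
no definition introduced.

WHAT THIS IS NOT: one reduction step; part 2 iterates it and truncates degrees. Nothing on the
lower-set case itself, on crux stmt-ValiantsHypothesis-14610, or on `VP` versus `VNP`.
-/

set_option linter.dupNamespace false

namespace Summit.ValiantsHypothesis.ValiantsHypothesis.Theorems.BarrierLever.DownCompression

open Finset MvPolynomial
open Summit.ValiantsHypothesis.ValiantsHypothesis.Theorems.BarrierLever.ProductStateSums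
  (castAdd_ne_natAdd partitionExpo_apply_castAdd partitionExpo_apply_natAdd)

/-! ## 1. The pure matrix lemma: moved and blocked rows -/

/-- **Row compression of a determinant.** Let `A, B` be square matrices, the rows being sorted into
MOVED rows (`mv`), BLOCKED rows (`bl`) and the rest, such that: `B` vanishes off the moved and blocked
rows; a blocked row of `B` equals the row `partner i` of `A`, and partners are neither moved nor
blocked; no row is both moved and blocked. If the matrix «`B` on the moved rows, `A` elsewhere» is
nonsingular, then `A + t • B` is nonsingular for some scalar `t`. -/
theorem det_ne_zero_of_rowCompression {ι : Type*} [Fintype ι] [DecidableEq ι]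
    (A B : Matrix ι ι ℂ) (mv bl : ι → Prop) [DecidablePred mv] [DecidablePred bl] (partner : ι → ι)
    (h0 : ∀ i, ¬ mv i → ¬ bl i → ∀ j, B i j = 0)
    (hbl : ∀ i, bl i → (∀ j, B i j = A (partner i) j) ∧ ¬ mv (partner i) ∧ ¬ bl (partner i))
    (hdisj : ∀ i, ¬ (mv i ∧ bl i))
    (hdet : (Matrix.of fun i j => if mv i then B i j else A i j).det ≠ 0) :
    ∃ t : ℂ, (Matrix.of fun i j => A i j + t * B i j).det ≠ 0 := by
  -- the pencil over `ℂ[X]`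
  set L : Matrix ι ι (Polynomial ℂ) :=
    Matrix.of fun i j => Polynomial.C (A i j) + Polynomial.X * Polynomial.C (B i j) with hL_def
  -- row operations: subtract `X ·` the partner row from every blocked row
  set E : Matrix ι ι (Polynomial ℂ) := Matrix.of fun i k =>
    (if i = k then (1 : Polynomial ℂ) else 0) -
      (if bl i ∧ k = partner i then Polynomial.X else 0) with hE_def
  set L' : Matrix ι ι (Polynomial ℂ) := E * L with hL'_def
  have hL'_apply : ∀ i j, L' i j = L i j - (if bl i then Polynomial.X * L (partner i) j else 0) := by
    intro i j
    rw [hL'_def, Matrix.mul_apply]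
    have hsplit : ∀ k, E i k * L k j =
        (if i = k then L k j else 0) - (if bl i ∧ k = partner i then Polynomial.X * L k j else 0) := by
      intro k
      rw [hE_def, Matrix.of_apply, sub_mul]
      congr 1
      · split_ifs <;> simp
      · split_ifs <;> simp
    rw [Finset.sum_congr rfl fun k _ => hsplit k, Finset.sum_sub_distrib, Finset.sum_ite_eq univ i,
      if_pos (Finset.mem_univ i)]
    congr 1
    by_cases hi : bl i
    · rw [if_pos hi]
      have : (fun k => if bl i ∧ k = partner i then Polynomial.X * L k j else 0) =
          fun k => if k = partner i then Polynomial.X * L k j else 0 := by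
        funext k
        by_cases hk : k = partner i
        · rw [if_pos ⟨hi, hk⟩, if_pos hk]
        · rw [if_neg (fun h => hk h.2), if_neg hk]
      rw [this, Finset.sum_ite_eq' univ (partner i), if_pos (Finset.mem_univ _)]
    · rw [if_neg hi]
      exact Finset.sum_eq_zero fun k _ => by rw [if_neg (fun h => hi h.1)]
  -- entries of `L'`
  have hentry_bl : ∀ i j, bl i → L' i j = Polynomial.C (A i j) := by
    intro i j hi
    obtain ⟨hB, hpm, hpb⟩ := hbl i hi
    rw [hL'_apply, if_pos hi, hL_def, Matrix.of_apply, Matrix.of_apply, hB j,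
      h0 (partner i) hpm hpb j, map_zero, mul_zero, add_zero]
    ring
  have hentry_mv : ∀ i j, mv i →
      L' i j = Polynomial.C (A i j) + Polynomial.X * Polynomial.C (B i j) := by
    intro i j hi
    have hb : ¬ bl i := fun h => hdisj i ⟨hi, h⟩
    rw [hL'_apply, if_neg hb, sub_zero, hL_def, Matrix.of_apply]
  have hentry_rest : ∀ i j, ¬ mv i → ¬ bl i → L' i j = Polynomial.C (A i j) := by
    intro i j hi hi'
    rw [hL'_apply, if_neg hi', sub_zero, hL_def, Matrix.of_apply, h0 i hi hi' j, map_zero, mul_zero,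
      add_zero]
  -- row degrees and top coefficients
  have hdeg : ∀ i j, (L' i j).natDegree ≤ (if mv i then 1 else 0) := by
    intro i j
    by_cases hi : mv i
    · rw [if_pos hi, hentry_mv i j hi]
      refine (Polynomial.natDegree_add_le _ _).trans (max_le ?_ ?_)
      · exact (Polynomial.natDegree_C _).le.trans zero_le_one
      · exact Polynomial.natDegree_mul_le.trans
          (by rw [Polynomial.natDegree_X, Polynomial.natDegree_C])
    · rw [if_neg hi]
      by_cases hi' : bl i
      · rw [hentry_bl i j hi', Polynomial.natDegree_C]
      · rw [hentry_rest i j hi hi', Polynomial.natDegree_C]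
  have hcoeff : ∀ i j, (L' i j).coeff (if mv i then 1 else 0) = if mv i then B i j else A i j := by
    intro i j
    by_cases hi : mv i
    · rw [if_pos hi, if_pos hi, hentry_mv i j hi]
      simp only [Polynomial.coeff_add, Polynomial.coeff_C_succ, Polynomial.coeff_X_mul,
        Polynomial.coeff_C_zero, zero_add]
    · rw [if_neg hi, if_neg hi]
      by_cases hi' : bl i
      · rw [hentry_bl i j hi', Polynomial.coeff_C_zero]
      · rw [hentry_rest i j hi hi', Polynomial.coeff_C_zero]
  -- the top coefficient of `det L'` (row version of the column-degree lemma, via the transpose)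
  have hL' : L'.det ≠ 0 := by
    intro h0'
    have hc := PriorityPeeling.coeff_det_of_natDegree_le_col L'.transpose
      (fun i => if mv i then 1 else 0) (fun i j => hdeg j i)
    rw [Matrix.det_transpose, h0', Polynomial.coeff_zero] at hc
    have hmat : (Matrix.of fun i j => (L'.transpose i j).coeff (if mv j then 1 else 0)) =
        (Matrix.of fun i j => if mv i then B i j else A i j).transpose := by
      ext i j
      rw [Matrix.of_apply, Matrix.transpose_apply, Matrix.transpose_apply, Matrix.of_apply, hcoeff]
    rw [hmat, Matrix.det_transpose] at hc
    exact hdet hc.symm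
  have hL : L.det ≠ 0 := by
    intro h0'
    apply hL'
    rw [hL'_def, Matrix.det_mul, h0', mul_zero]
  obtain ⟨t, ht⟩ := PriorityPeeling.exists_eval_ne_zero_of_ne_zero _ hL
  refine ⟨t, ?_⟩
  have hmap : (Matrix.of fun i j => A i j + t * B i j) = L.map (Polynomial.eval t) := by
    ext i j
    simp only [hL_def, Matrix.map_apply, Matrix.of_apply, Polynomial.eval_add, Polynomial.eval_C,
      Polynomial.eval_mul, Polynomial.eval_X]
  rw [hmap]
  have := RingHom.map_det (Polynomial.evalRingHom t) L
  rw [RingHom.mapMatrix_apply, Polynomial.coe_evalRingHom] at this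
  rw [← this]
  exact ht

/-! ## 2. One linear factor acts on the partition matrix by a Kronecker elementary matrix -/

variable {h : ℕ}

/-- `x^U y^W = x_a · x^{U∖a} y^W` on exponents, for `a ∈ U`. -/
theorem partitionExpo_eq_single_add_erase (U W : Finset (Fin h)) (a : Fin h) (ha : a ∈ U) :
    (∑ a' ∈ U, Finsupp.single (Fin.castAdd h a') 1 + ∑ c ∈ W, Finsupp.single (Fin.natAdd h c) 1 :
      Fin (h + h) →₀ ℕ) =
      Finsupp.single (Fin.castAdd h a) 1 + (∑ a' ∈ U.erase a, Finsupp.single (Fin.castAdd h a') 1 +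
        ∑ c ∈ W, Finsupp.single (Fin.natAdd h c) 1) := by
  rw [← add_assoc, Finset.add_sum_erase U (fun a' => Finsupp.single (Fin.castAdd h a') (1 : ℕ)) ha]

/-- `x^U y^W = y_c · x^U y^{W∖c}` on exponents, for `c ∈ W`. -/
theorem partitionExpo_eq_single_add_erase_y (U W : Finset (Fin h)) (c : Fin h) (hc : c ∈ W) :
    (∑ a' ∈ U, Finsupp.single (Fin.castAdd h a') 1 + ∑ c' ∈ W, Finsupp.single (Fin.natAdd h c') 1 :
      Fin (h + h) →₀ ℕ) =
      Finsupp.single (Fin.natAdd h c) 1 + (∑ a' ∈ U, Finsupp.single (Fin.castAdd h a') 1 +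
        ∑ c' ∈ W.erase c, Finsupp.single (Fin.natAdd h c') 1) := by
  rw [add_left_comm,
    Finset.add_sum_erase W (fun c' => Finsupp.single (Fin.natAdd h c') (1 : ℕ)) hc]

/-- **One `x`-factor.** For EVERY polynomial `f`:
`coeff_{x^U y^W} (f · (1 + t x_a)) = coeff_{x^U y^W} f + t · [a ∈ U] · coeff_{x^{U∖a} y^W} f`. -/
theorem coeff_partitionExpo_mul_one_add_x (f : MvPolynomial (Fin (h + h)) ℂ) (t : ℂ) (a : Fin h)
    (U W : Finset (Fin h)) :
    coeff (∑ a' ∈ U, Finsupp.single (Fin.castAdd h a') 1 + ∑ c ∈ W, Finsupp.single (Fin.natAdd h c) 1)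
        (f * (1 + C t * X (Fin.castAdd h a))) =
      coeff (∑ a' ∈ U, Finsupp.single (Fin.castAdd h a') 1 +
          ∑ c ∈ W, Finsupp.single (Fin.natAdd h c) 1) f +
        t * (if a ∈ U then coeff (∑ a' ∈ U.erase a, Finsupp.single (Fin.castAdd h a') 1 +
          ∑ c ∈ W, Finsupp.single (Fin.natAdd h c) 1) f else 0) := by
  classical
  have hrw : f * (1 + C t * X (Fin.castAdd h a)) = f + C t * (f * X (Fin.castAdd h a)) := by ring
  rw [hrw, coeff_add, coeff_C_mul, coeff_mul_X']
  congr 2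
  have hmem : (Fin.castAdd h a ∈ (∑ a' ∈ U, Finsupp.single (Fin.castAdd h a') 1 +
      ∑ c ∈ W, Finsupp.single (Fin.natAdd h c) 1 : Fin (h + h) →₀ ℕ).support) ↔ a ∈ U := by
    rw [Finsupp.mem_support_iff]
    have := partitionExpo_apply_castAdd U W a
    simp only [Finsupp.coe_add, Finsupp.coe_finsetSum] at this ⊢
    rw [this]
    by_cases ha : a ∈ U <;> simp [ha]
  by_cases ha : a ∈ U
  · rw [if_pos (hmem.mpr ha), if_pos ha, partitionExpo_eq_single_add_erase U W a ha,
      add_tsub_cancel_left]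
  · rw [if_neg (fun h' => ha (hmem.mp h')), if_neg ha]

/-- **One `y`-factor.** For EVERY polynomial `f`:
`coeff_{x^U y^W} (f · (1 + s y_c)) = coeff_{x^U y^W} f + s · [c ∈ W] · coeff_{x^U y^{W∖c}} f`. -/
theorem coeff_partitionExpo_mul_one_add_y (f : MvPolynomial (Fin (h + h)) ℂ) (s : ℂ) (c : Fin h)
    (U W : Finset (Fin h)) :
    coeff (∑ a' ∈ U, Finsupp.single (Fin.castAdd h a') 1 + ∑ c' ∈ W, Finsupp.single (Fin.natAdd h c') 1)
        (f * (1 + C s * X (Fin.natAdd h c))) =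
      coeff (∑ a' ∈ U, Finsupp.single (Fin.castAdd h a') 1 +
          ∑ c' ∈ W, Finsupp.single (Fin.natAdd h c') 1) f +
        s * (if c ∈ W then coeff (∑ a' ∈ U, Finsupp.single (Fin.castAdd h a') 1 +
          ∑ c' ∈ W.erase c, Finsupp.single (Fin.natAdd h c') 1) f else 0) := by
  classical
  have hrw : f * (1 + C s * X (Fin.natAdd h c)) = f + C s * (f * X (Fin.natAdd h c)) := by ring
  rw [hrw, coeff_add, coeff_C_mul, coeff_mul_X']
  congr 2
  have hmem : (Fin.natAdd h c ∈ (∑ a' ∈ U, Finsupp.single (Fin.castAdd h a') 1 +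
      ∑ c' ∈ W, Finsupp.single (Fin.natAdd h c') 1 : Fin (h + h) →₀ ℕ).support) ↔ c ∈ W := by
    rw [Finsupp.mem_support_iff]
    have := partitionExpo_apply_natAdd U W c
    simp only [Finsupp.coe_add, Finsupp.coe_finsetSum] at this ⊢
    rw [this]
    by_cases hc : c ∈ W <;> simp [hc]
  by_cases hc : c ∈ W
  · rw [if_pos (hmem.mpr hc), if_pos hc, partitionExpo_eq_single_add_erase_y U W c hc,
      add_tsub_cancel_left]
  · rw [if_neg (fun h' => hc (hmem.mp h')), if_neg hc]

variable {r : ℕ}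

/-! ## 3. The reduction steps -/

/-- **Step in `x`.** If `v` is the `a`-compression of the row family `u` (no injectivity needed) and some `f` makes
the partition minor of `(v, w)` nonzero, then `f · (1 + t x_a)` makes the partition minor of `(u, w)`
nonzero for some `t`. -/
theorem step_x (u v w : Fin r → Finset (Fin h)) (a : Fin h)
    (hv₁ : ∀ i, a ∈ u i → (∀ k, u k ≠ (u i).erase a) → v i = (u i).erase a)
    (hv₂ : ∀ i, ¬ (a ∈ u i ∧ ∀ k, u k ≠ (u i).erase a) → v i = u i)
    (f : MvPolynomial (Fin (h + h)) ℂ)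
    (hdet : (Matrix.of fun i j : Fin r => MvPolynomial.coeff
      (∑ a' ∈ v i, Finsupp.single (Fin.castAdd h a') 1 +
        ∑ c ∈ w j, Finsupp.single (Fin.natAdd h c) 1) f).det ≠ 0) :
    ∃ t : ℂ, (Matrix.of fun i j : Fin r => MvPolynomial.coeff
      (∑ a' ∈ u i, Finsupp.single (Fin.castAdd h a') 1 +
        ∑ c ∈ w j, Finsupp.single (Fin.natAdd h c) 1) (f * (1 + C t * X (Fin.castAdd h a)))).det ≠ 0 := by
  classical
  -- the data of the matrix lemma
  let A : Matrix (Fin r) (Fin r) ℂ := fun i j => MvPolynomial.coeff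
    (∑ a' ∈ u i, Finsupp.single (Fin.castAdd h a') 1 + ∑ c ∈ w j, Finsupp.single (Fin.natAdd h c) 1) f
  let B : Matrix (Fin r) (Fin r) ℂ := fun i j => if a ∈ u i then MvPolynomial.coeff
    (∑ a' ∈ (u i).erase a, Finsupp.single (Fin.castAdd h a') 1 +
      ∑ c ∈ w j, Finsupp.single (Fin.natAdd h c) 1) f else 0
  let mv : Fin r → Prop := fun i => a ∈ u i ∧ ∀ k, u k ≠ (u i).erase a
  let bl : Fin r → Prop := fun i => a ∈ u i ∧ ∃ k, u k = (u i).erase a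
  let partner : Fin r → Fin r := fun i => if hk : ∃ k, u k = (u i).erase a then hk.choose else i
  have hpartner : ∀ i, (hk : ∃ k, u k = (u i).erase a) → u (partner i) = (u i).erase a := by
    intro i hk
    simp only [partner, dif_pos hk]
    exact hk.choose_spec
  obtain ⟨t, ht⟩ := det_ne_zero_of_rowCompression A B mv bl partner
    (fun i hm hb j => by
      have hai : a ∉ u i := fun hai => by
        by_cases hk : ∃ k, u k = (u i).erase a
        · exact hb ⟨hai, hk⟩
        · push Not at hk; exact hm ⟨hai, hk⟩
      simp only [B, if_neg hai])
    (fun i hb => by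
      have hp := hpartner i hb.2
      have hap : a ∉ u (partner i) := by rw [hp]; exact Finset.notMem_erase a _
      refine ⟨fun j => ?_, fun hm => hap hm.1, fun hb' => hap hb'.1⟩
      simp only [A, B, if_pos hb.1, hp])
    (fun i hmb => by obtain ⟨k, hk⟩ := hmb.2.2; exact hmb.1.2 k hk)
    (by
      have hmat : (Matrix.of fun i j => if mv i then B i j else A i j) =
          Matrix.of fun i j : Fin r => MvPolynomial.coeff
            (∑ a' ∈ v i, Finsupp.single (Fin.castAdd h a') 1 +
              ∑ c ∈ w j, Finsupp.single (Fin.natAdd h c) 1) f := by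
        ext i j
        simp only [Matrix.of_apply]
        by_cases hi : mv i
        · simp only [if_pos hi, B, if_pos hi.1, hv₁ i hi.1 hi.2]
        · simp only [if_neg hi, A, hv₂ i hi]
      rw [hmat]; exact hdet)
  refine ⟨t, ?_⟩
  have hmat : (Matrix.of fun i j : Fin r => MvPolynomial.coeff
      (∑ a' ∈ u i, Finsupp.single (Fin.castAdd h a') 1 +
        ∑ c ∈ w j, Finsupp.single (Fin.natAdd h c) 1) (f * (1 + C t * X (Fin.castAdd h a)))) =
      Matrix.of fun i j => A i j + t * B i j := by
    ext i j
    simp only [Matrix.of_apply, coeff_partitionExpo_mul_one_add_x, A, B]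
  rw [hmat]
  exact ht

/-- **Step in `y`.** If `w'` is the `c`-compression of the column family `w` and some `f`
makes the partition minor of `(u, w')` nonzero, then `f · (1 + s y_c)` makes the partition minor of
`(u, w)` nonzero for some `s`. -/
theorem step_y (u w w' : Fin r → Finset (Fin h)) (c : Fin h)
    (hw₁ : ∀ j, c ∈ w j → (∀ k, w k ≠ (w j).erase c) → w' j = (w j).erase c)
    (hw₂ : ∀ j, ¬ (c ∈ w j ∧ ∀ k, w k ≠ (w j).erase c) → w' j = w j)
    (f : MvPolynomial (Fin (h + h)) ℂ)
    (hdet : (Matrix.of fun i j : Fin r => MvPolynomial.coeff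
      (∑ a ∈ u i, Finsupp.single (Fin.castAdd h a) 1 +
        ∑ c' ∈ w' j, Finsupp.single (Fin.natAdd h c') 1) f).det ≠ 0) :
    ∃ s : ℂ, (Matrix.of fun i j : Fin r => MvPolynomial.coeff
      (∑ a ∈ u i, Finsupp.single (Fin.castAdd h a) 1 +
        ∑ c' ∈ w j, Finsupp.single (Fin.natAdd h c') 1) (f * (1 + C s * X (Fin.natAdd h c)))).det ≠ 0 := by
  classical
  -- transpose: columns become rows
  let A : Matrix (Fin r) (Fin r) ℂ := fun j i => MvPolynomial.coeff
    (∑ a ∈ u i, Finsupp.single (Fin.castAdd h a) 1 + ∑ c' ∈ w j, Finsupp.single (Fin.natAdd h c') 1) f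
  let B : Matrix (Fin r) (Fin r) ℂ := fun j i => if c ∈ w j then MvPolynomial.coeff
    (∑ a ∈ u i, Finsupp.single (Fin.castAdd h a) 1 +
      ∑ c' ∈ (w j).erase c, Finsupp.single (Fin.natAdd h c') 1) f else 0
  let mv : Fin r → Prop := fun j => c ∈ w j ∧ ∀ k, w k ≠ (w j).erase c
  let bl : Fin r → Prop := fun j => c ∈ w j ∧ ∃ k, w k = (w j).erase c
  let partner : Fin r → Fin r := fun j => if hk : ∃ k, w k = (w j).erase c then hk.choose else j
  have hpartner : ∀ j, (hk : ∃ k, w k = (w j).erase c) → w (partner j) = (w j).erase c := by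
    intro j hk
    simp only [partner, dif_pos hk]
    exact hk.choose_spec
  obtain ⟨s, hs⟩ := det_ne_zero_of_rowCompression A B mv bl partner
    (fun j hm hb i => by
      have hcj : c ∉ w j := fun hcj => by
        by_cases hk : ∃ k, w k = (w j).erase c
        · exact hb ⟨hcj, hk⟩
        · push Not at hk; exact hm ⟨hcj, hk⟩
      simp only [B, if_neg hcj])
    (fun j hb => by
      have hp := hpartner j hb.2
      have hcp : c ∉ w (partner j) := by rw [hp]; exact Finset.notMem_erase c _
      refine ⟨fun i => ?_, fun hm => hcp hm.1, fun hb' => hcp hb'.1⟩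
      simp only [A, B, if_pos hb.1, hp])
    (fun j hmb => by obtain ⟨k, hk⟩ := hmb.2.2; exact hmb.1.2 k hk)
    (by
      have hmat : (Matrix.of fun j i => if mv j then B j i else A j i) =
          (Matrix.of fun i j : Fin r => MvPolynomial.coeff
            (∑ a ∈ u i, Finsupp.single (Fin.castAdd h a) 1 +
              ∑ c' ∈ w' j, Finsupp.single (Fin.natAdd h c') 1) f).transpose := by
        ext j i
        simp only [Matrix.of_apply, Matrix.transpose_apply]
        by_cases hj : mv j
        · simp only [if_pos hj, B, if_pos hj.1, hw₁ j hj.1 hj.2]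
        · simp only [if_neg hj, A, hw₂ j hj]
      rw [hmat, Matrix.det_transpose]; exact hdet)
  refine ⟨s, ?_⟩
  have hmat : (Matrix.of fun i j : Fin r => MvPolynomial.coeff
      (∑ a ∈ u i, Finsupp.single (Fin.castAdd h a) 1 +
        ∑ c' ∈ w j, Finsupp.single (Fin.natAdd h c') 1) (f * (1 + C s * X (Fin.natAdd h c)))) =
      (Matrix.of fun j i => A j i + s * B j i).transpose := by
    ext i j
    simp only [Matrix.of_apply, Matrix.transpose_apply, coeff_partitionExpo_mul_one_add_y, A, B]
  rw [hmat, Matrix.det_transpose]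
  exact hs

end Summit.ValiantsHypothesis.ValiantsHypothesis.Theorems.BarrierLever.DownCompression
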